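import Literature.NumberTheory.ModularForms.ModPModularFormsThetaFiltration
import Literature.NumberTheory.ModularForms.QExpansionAlgebra
import Literature.NumberTheory.ModularForms.QExpansionDerivative
import Literature.NumberTheory.EllipticCurves.ModularFormsRamanujan
import Literature.NumberTheory.EllipticCurves.ModularFunctionField
import Mathlib.NumberTheory.ModularForms.EisensteinSeries.E2.Summable
import HarnessLib

/-!
# Modular forms mod `p` on `Γ₁(N)`: products, level-one forms and the Serre derivative preserve rational `p`-integral
# `q`-expansions (Serre / Swinnerton-Dyer, the classical half of "`θ` raises the weight by `p + 1`")

Topic `Literature/NumberTheory/ModularForms`, sub-namespace `ModP`. THEOREMS ONLY (no definition, no named fact); sequel of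
`ModPModularFormsQExpansion.lean` (`HasRationalPIntegralQExpansion`, `modPForms`, `theta`) preparing the classical DISCHARGE of the
named fact `ModP.ThetaMem` ("`θ` maps `M̃_k(N)` to `M̃_{k+p+1}(N)`", Katz 1977 Thm. (1); file `ModPModularFormsThetaMemProof.lean`) along
the original route of Serre and Swinnerton-Dyer: `θ f = ϑ_k f + (k/12) E₂ f` with `ϑ_k` the Serre derivative, and mod `p`,
`E₂ ≡ E_{p+1}`, `E_{p−1} ≡ 1` [SwinnertonDyer1973, §3, Lemma 5 (i) and its proof: "`θ f ≡ ... ` has filtration `≤ k + p + 1`";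
Serre1973ZetaPadiques, §1.4 Thm. 5 proof]. Here: the bookkeeping that products (Mathlib `ModularForm.mul`), weight casts, rational
multiples, level-one forms viewed on `Γ₁(N)` (`ofLevelOne`), and the Serre derivative `ϑ_k f = Df − (k/12)E₂f` (a modular form of
weight `k + 2` on `Γ₁(N)`: Mathlib's slash-equivariance + `D g → 0` at `i∞` for nice `g`, as in the tree's `SerreDerivativeModularForm`
for `Γ₀(N)`) carry rational `p`-integral `q`-expansions to rational
`p`-integral `q`-expansions, with the expected coefficient sequences.

* §1 `HasRationalPIntegralQExpansion.mul` (Cauchy product of the `ℤ_p`-sequences), `.mcast`, `.ratCast_smul`, `.ofLevelOne`.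
* §2 `exists_modularForm_coe_eq_serreDerivative` — `ϑ_k : M_k(Γ₁(N)) → M_{k+2}(Γ₁(N))` (existence of the form, no new definition).
* §3 `qExpansion_E2_coeff` (`E₂ = 1 − 24 Σ σ₁(n) qⁿ`, Mathlib `hasSum_qExpansion_E2`), `qExpansion_serreDerivative_coeff`
  (`(ϑf)ₙ = n aₙ − (k/12) Σ_{i+j=n} (E₂)ᵢ aⱼ`).
* §4 `HasRationalPIntegralQExpansion.serreDerivative` — for `p ∤ 12`: the `ℤ_p`-sequence of `ϑ_k f` is
  `n xₙ − (k/12) Σ_{i+j=n} e₂(i) xⱼ`, `e₂(0) = 1`, `e₂(i) = −24σ₁(i)`.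

## References
* [SwinnertonDyer1973] H. P. F. Swinnerton-Dyer, LNM 350 (1973), §3 (the operator `θ = q d/dq` mod `p`, `θ f = ϑf + (k/12)Pf`).
* [Serre1973ZetaPadiques] J.-P. Serre, LNM 350 (1973), §1.4 (`θ`, `∂`, filtration).
* [Zagier2008] D. Zagier, *Elliptic modular forms and their applications*, §5.1 Prop. 15, (53) (`ϑ_k : M_k → M_{k+2}`; `Df = ϑf + (k/12)E₂f`).
* [Jochnowitz1982] §1 Def. 1.1 (the currency `M̃_k(N)`).
-/

noncomputable section

open scoped Classical MatrixGroups ArithmeticFunction.sigma ModularForm Manifold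
open UpperHalfPlane hiding I
open PowerSeries CongruenceSubgroup Function Derivative EisensteinSeries Finset
open Literature.NumberTheory.EllipticCurves.ModularForms (ofLevelOne coe_ofLevelOne periodic_E2_comp_ofComplex)

namespace Literature.NumberTheory.ModularForms.ModP

variable {p : ℕ} [Fact p.Prime] {N : ℕ}

/-- `1` is a strict period of `Γ₁(N)` (Mathlib `strictPeriods_Gamma1`). [folklore] -/
private theorem one_mem_strictPeriods_Gamma1' (N : ℕ) : (1 : ℝ) ∈ (Gamma1 N : Subgroup (GL (Fin 2) ℝ)).strictPeriods := by
  rw [strictPeriods_Gamma1]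
  exact AddSubgroup.mem_zmultiples 1

/-! ## §1 Products, casts, rational multiples, level one -/

/-- **Products.** If `f ∈ M_{k₁}(Γ₁(N))`, `g ∈ M_{k₂}(Γ₁(N))` have rational `p`-integral expansions recorded by `x`, `y : ℕ → ℤ_p`, then
`f·g` (Mathlib `ModularForm.mul`) has the rational `p`-integral expansion recorded by the Cauchy product `n ↦ Σ_{i+j=n} xᵢ yⱼ`
(Mathlib `ModularForm.qExpansion_mul`). [cite: Jochnowitz1982, §1 Def. 1.1 p. 270] -/
theorem HasRationalPIntegralQExpansion.mul {k₁ k₂ : ℤ} {f : ModularForm (Gamma1 N) k₁} {g : ModularForm (Gamma1 N) k₂}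
    {x y : ℕ → ℤ_[p]} (hf : HasRationalPIntegralQExpansion p f x) (hg : HasRationalPIntegralQExpansion p g y) :
    HasRationalPIntegralQExpansion p (f.mul g) (fun n => ∑ ij ∈ antidiagonal n, x ij.1 * y ij.2) := by
  choose a ha hxa using hf
  choose b hb hyb using hg
  intro n
  refine ⟨∑ ij ∈ antidiagonal n, a ij.1 * b ij.2, ?_, ?_⟩
  · rw [ModularForm.qExpansion_mul one_pos (one_mem_strictPeriods_Gamma1' N) f g, coeff_mul]
    push_cast
    exact sum_congr rfl fun ij _ => by rw [ha, hb]
  · rw [PadicInt.coe_sum]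
    push_cast
    exact sum_congr rfl fun ij _ => by rw [hxa, hyb]

/-- **Weight casts** (Mathlib `ModularForm.mcast`, same function) keep the expansion. [cite: Jochnowitz1982, §1 Def. 1.1 p. 270] -/
theorem HasRationalPIntegralQExpansion.mcast {a b : ℤ} (h : a = b) {f : ModularForm (Gamma1 N) a} {x : ℕ → ℤ_[p]}
    (hf : HasRationalPIntegralQExpansion p f x) : HasRationalPIntegralQExpansion p (ModularForm.mcast h f) x :=
  fun n => hf n

/-- **Rational multiples.** For `c ∈ ℚ ∩ ℤ_p` (witnessed by `xc : ℤ_p` with `xc = c` in `ℚ_p`), `c • f` has the expansion `xc · x`.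
[cite: Jochnowitz1982, §1 Def. 1.1 p. 270] -/
theorem HasRationalPIntegralQExpansion.ratCast_smul {k : ℤ} {f : ModularForm (Gamma1 N) k} {x : ℕ → ℤ_[p]}
    (hf : HasRationalPIntegralQExpansion p f x) {c : ℚ} {xc : ℤ_[p]} (hc : (xc : ℚ_[p]) = (c : ℚ_[p])) :
    HasRationalPIntegralQExpansion p ((c : ℂ) • f) (fun n => xc * x n) := by
  intro n
  obtain ⟨a, ha, hxa⟩ := hf n
  refine ⟨c * a, ?_, ?_⟩
  · rw [ModularForm.IsGLPos.coe_smul, ModularForm.qExpansion_smul one_pos (one_mem_strictPeriods_Gamma1' N) (c : ℂ) f, map_smul,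
      ha, smul_eq_mul, Rat.cast_mul]
  · rw [PadicInt.coe_mul, hc, hxa, Rat.cast_mul]

/-- **Level-one forms on `Γ₁(N)`** (`ofLevelOne`, same function): an explicit rational expansion `a` with `ℤ_p`-incarnation `x` of
`F ∈ M_k(SL₂(ℤ))` is one of `F|_{Γ₁(N)}`. [cite: Jochnowitz1982, §1 Def. 1.1 p. 270] -/
theorem HasRationalPIntegralQExpansion.ofLevelOne {k : ℤ} {F : ModularForm 𝒮ℒ k} {x : ℕ → ℤ_[p]} (a : ℕ → ℚ)
    (hF : ∀ n, coeff n (qExpansion 1 ⇑F) = (a n : ℂ)) (hx : ∀ n, ((x n : ℤ_[p]) : ℚ_[p]) = (a n : ℚ_[p])) :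
    HasRationalPIntegralQExpansion p (ofLevelOne (Gamma1 N) F) x :=
  fun n => ⟨a n, by rw [coe_ofLevelOne, hF], hx n⟩

/-! ## §2 The Serre derivative on `Γ₁(N)` -/

/-- `Γ(N) ≤ Γ₁(N)`. [folklore] -/
private theorem Gamma_le_Gamma1' (N : ℕ) : Gamma N ≤ Gamma1 N := by
  intro g hg
  rw [Gamma_mem] at hg
  rw [Gamma1_mem]
  exact ⟨hg.1, hg.2.2.2, hg.2.2.1⟩

/-- The translate `f|γ` (`γ ∈ SL₂(ℤ)`) of `f ∈ M_k(Γ₁(N))` is `Γ(N)`-invariant (`Γ(N)` is normal in `SL₂(ℤ)`), hence `N`-periodic.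
[folklore] -/
private theorem periodic_slash_comp_ofComplex {k : ℤ} (f : ModularForm (Gamma1 N) k) (r : SL(2, ℤ)) :
    Periodic ((⇑f ∣[k] r) ∘ ofComplex) (N : ℕ) := by
  let G : SlashInvariantForm (Gamma N) k :=
    { toFun := ⇑f ∣[k] r
      slash_action_eq' := fun γ hγ => by
        obtain ⟨g, hg, rfl⟩ := hγ
        have hconj : r * g * r⁻¹ ∈ Gamma1 N := Gamma_le_Gamma1' N ((Gamma_normal N).conj_mem g hg r)
        have hinv : (⇑f) ∣[k] (Matrix.SpecialLinearGroup.mapGL ℝ (r * g * r⁻¹)) = ⇑f :=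
          SlashInvariantFormClass.slash_action_eq f _ ⟨r * g * r⁻¹, hconj, rfl⟩
        have hr : (⇑f) ∣[k] r = (⇑f) ∣[k] (Matrix.SpecialLinearGroup.mapGL ℝ r) := ModularForm.SL_slash _ r
        change ((⇑f) ∣[k] r) ∣[k] (Matrix.SpecialLinearGroup.mapGL ℝ g) = (⇑f) ∣[k] r
        rw [hr, ← SlashAction.slash_mul, ← map_mul, show r * g = r * g * r⁻¹ * r by group, map_mul,
          SlashAction.slash_mul, hinv] }
  have hN : ((N : ℕ) : ℝ) ∈ (Gamma N : Subgroup (GL (Fin 2) ℝ)).strictPeriods := by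
    rw [strictPeriods_Gamma]
    exact AddSubgroup.mem_zmultiples _
  exact SlashInvariantFormClass.periodic_comp_ofComplex G hN

/-- The Serre derivative of `f ∈ M_k(Γ₁(N))` is bounded at `i∞` after slashing by any `γ ∈ SL₂(ℤ)`: `(ϑf)|γ = ϑ(f|γ)` (Mathlib
`serreDerivative_slash_equivariant`), `f|γ` is `N`-periodic, holomorphic and bounded, so `D(f|γ) → 0` (tree
`isZeroAtImInfty_normalizedDeriv`) and `E₂·(f|γ)` is bounded. [cite: Zagier2008, §5.1 Prop. 15] -/
theorem isBoundedAtImInfty_serreDerivative_slash_gamma1 [NeZero N] {k : ℤ} (f : ModularForm (Gamma1 N) k) (γ : SL(2, ℤ)) :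
    IsBoundedAtImInfty (_root_.Derivative.serreDerivative k ⇑f ∣[k + 2] γ) := by
  rw [serreDerivative_slash_equivariant (ModularFormClass.holo f)]
  set G : ℍ → ℂ := (⇑f) ∣[k] γ with hG
  have hGhol : MDiff G := (ModularFormClass.holo f).slash k γ
  have hGbdd : IsBoundedAtImInfty G := ModularFormClass.bdd_at_infty_slash f γ
  have hGper : Periodic (G ∘ ofComplex) (N : ℕ) := periodic_slash_comp_ofComplex f γ
  have hD : IsBoundedAtImInfty (D G) :=
    (Literature.NumberTheory.EllipticCurves.ModularForms.isZeroAtImInfty_normalizedDeriv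
      (h := ((N : ℕ) : ℝ)) (by exact_mod_cast NeZero.pos N) hGper hGhol hGbdd).boundedAtFilter
  have hE : IsBoundedAtImInfty (fun z => (k : ℂ) * 12⁻¹ * E2 z * G z) := by
    have h0 := (isBoundedAtImInfty_E2.mul hGbdd).const_mul_left ((k : ℂ) * 12⁻¹)
    have hfun : (fun z => (k : ℂ) * 12⁻¹ * E2 z * G z) = fun z => (k : ℂ) * 12⁻¹ * (E2 * G) z := by
      funext z; simp only [Pi.mul_apply]; ring
    rw [hfun]
    exact h0
  have hfun : _root_.Derivative.serreDerivative k G = fun z => D G z - (k : ℂ) * 12⁻¹ * E2 z * G z := by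
    funext z; rw [serreDerivative_apply]
  rw [hfun]
  exact hD.sub hE

/-- **`ϑ_k : M_k(Γ₁(N)) → M_{k+2}(Γ₁(N))`**: the Serre derivative `ϑ_k f = Df − (k/12)E₂f` of `f ∈ M_k(Γ₁(N))` is (the function of)
a modular form of weight `k + 2` on `Γ₁(N)` — invariance `serreDerivative_slash_invariant` (Mathlib), holomorphy, and boundedness at
every cusp (`isBoundedAtImInfty_serreDerivative_slash_gamma1`). Stated as an existence to avoid a new definition (the tree's
`serreDerivativeGamma0` is the `Γ₀(N)` twin). [cite: Zagier2008, §5.1 Prop. 15] -/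
theorem exists_modularForm_coe_eq_serreDerivative [NeZero N] {k : ℤ} (f : ModularForm (Gamma1 N) k) :
    ∃ g : ModularForm (Gamma1 N) (k + 2), ⇑g = _root_.Derivative.serreDerivative k ⇑f :=
  ⟨{ toFun := _root_.Derivative.serreDerivative k f
     slash_action_eq' := fun A hA => by
       obtain ⟨γ, hγ, rfl⟩ := hA
       exact serreDerivative_slash_invariant (ModularFormClass.holo f)
         (SlashInvariantFormClass.slash_action_eq f γ ⟨γ, hγ, rfl⟩)
     holo' := serreDerivative_mdifferentiable k (ModularFormClass.holo f)
     bdd_at_cusps' := fun hcusp => by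
       rw [Subgroup.IsArithmetic.isCusp_iff_isCusp_SL2Z] at hcusp
       rw [OnePoint.isBoundedAt_iff_forall_SL2Z hcusp]
       intro γ _
       exact isBoundedAtImInfty_serreDerivative_slash_gamma1 f γ }, rfl⟩

/-! ## §3 `q`-expansions of `E₂` and of the Serre derivative -/

/-- **`E₂ = 1 − 24 Σ_{n ≥ 1} σ₁(n) qⁿ`** coefficientwise (Mathlib `hasSum_qExpansion_E2`, read through the uniqueness of `q`-expansion
coefficients of nice functions). [cite: Zagier2008, §2.3 (17)] -/
theorem qExpansion_E2_coeff (n : ℕ) :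
    coeff n (qExpansion 1 E2) = if n = 0 then 1 else -24 * ((σ 1 n : ℕ) : ℂ) := by
  refine qExpansion_coeff_eq_of_hasSum periodic_E2_comp_ofComplex E2_mdifferentiable isBoundedAtImInfty_E2
    (c := fun m => if m = 0 then 1 else -24 * ((σ 1 m : ℕ) : ℂ)) (fun τ => ?_) n
  simpa only [Periodic.qParam, Complex.ofReal_one, div_one] using hasSum_qExpansion_E2 (z := τ)

/-- A modular form on `Γ₁(N)` is nice of period `1` (periodic, holomorphic, bounded at `i∞`). [folklore] -/
private theorem nice_coe {k : ℤ} (f : ModularForm (Gamma1 N) k) :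
    Periodic (⇑f ∘ ofComplex) 1 ∧ MDiff ⇑f ∧ IsBoundedAtImInfty ⇑f := by
  have : Fact (IsCusp OnePoint.infty (Gamma1 N : Subgroup (GL (Fin 2) ℝ))) :=
    ⟨Subgroup.isCusp_of_mem_strictPeriods one_pos (one_mem_strictPeriods_Gamma1' N)⟩
  exact ⟨SlashInvariantFormClass.periodic_comp_ofComplex f (one_mem_strictPeriods_Gamma1' N), ModularFormClass.holo f,
    ModularFormClass.bdd_at_infty f⟩

/-- `E₂` is nice of period `1`. [folklore] -/
private theorem nice_E2 : Periodic (E2 ∘ ofComplex) 1 ∧ MDiff E2 ∧ IsBoundedAtImInfty E2 :=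
  ⟨periodic_E2_comp_ofComplex, E2_mdifferentiable, isBoundedAtImInfty_E2⟩

/-- **The `q`-expansion of the Serre derivative**: `(ϑ_k f)ₙ = n·aₙ − (k/12) Σ_{i+j=n} (E₂)ᵢ aⱼ` for `f = Σ aₙ qⁿ ∈ M_k(Γ₁(N))`
(`Df = Σ n aₙ qⁿ`, tree `qExpansion_D_coeff`; products and differences of nice functions). [cite: Zagier2008, §5.1 (53)] -/
theorem qExpansion_serreDerivative_coeff {k : ℤ} (f : ModularForm (Gamma1 N) k) (n : ℕ) :
    coeff n (qExpansion 1 (serreDerivative k ⇑f)) =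
      (n : ℂ) * coeff n (qExpansion 1 ⇑f) -
        (k : ℂ) * 12⁻¹ * ∑ ij ∈ antidiagonal n, coeff ij.1 (qExpansion 1 E2) * coeff ij.2 (qExpansion 1 ⇑f) := by
  have hf := nice_coe f
  have hD : Periodic (D ⇑f ∘ ofComplex) 1 ∧ MDiff (D ⇑f) ∧ IsBoundedAtImInfty (D ⇑f) :=
    ⟨periodic_D hf.1, normalizedDerivOfComplex_mdifferentiable hf.2.1, isBoundedAtImInfty_D hf.1 hf.2.1 hf.2.2⟩
  have hEf := QExpansionAlgebra.nice_mul nice_E2 hf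
  have hsEf := QExpansionAlgebra.nice_smul ((k : ℂ) * 12⁻¹) hEf
  have hfun : serreDerivative k ⇑f = D ⇑f - ((k : ℂ) * 12⁻¹) • (E2 * ⇑f) := by
    funext z
    simp only [serreDerivative_apply, Pi.sub_apply, Pi.smul_apply, Pi.mul_apply, smul_eq_mul]
    ring
  rw [hfun, QExpansionAlgebra.qExpansion_sub_of_nice one_pos hD hsEf, QExpansionAlgebra.qExpansion_smul_of_nice one_pos _ hEf,
    QExpansionAlgebra.qExpansion_mul_of_nice one_pos nice_E2 hf, map_sub, map_smul, coeff_mul, smul_eq_mul,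
    qExpansion_D_coeff hf.1 hf.2.1 hf.2.2]

/-! ## §4 The Serre derivative preserves rational `p`-integral expansions (`p ∤ 12`) -/

/-- **`ϑ_k` on rational `p`-integral expansions.** If `f ∈ M_k(Γ₁(N))` has the rational `p`-integral expansion `x`, `g` is the weight
`k + 2` form with `⇑g = ϑ_k f`, and `kc ∈ ℤ_p` is `k/12` (so `p ∤ 12`), then `g` has the rational `p`-integral expansion
`n ↦ n·xₙ − kc·Σ_{i+j=n} e₂(i) xⱼ` with `e₂(0) = 1`, `e₂(i) = −24σ₁(i)` (the integer coefficients of `E₂`).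
[cite: SwinnertonDyer1973, §3 (proof of Lemma 5)] -/
theorem HasRationalPIntegralQExpansion.serreDerivative {k : ℤ} {f : ModularForm (Gamma1 N) k} {x : ℕ → ℤ_[p]}
    (hf : HasRationalPIntegralQExpansion p f x) {g : ModularForm (Gamma1 N) (k + 2)} (hg : ⇑g = _root_.Derivative.serreDerivative k ⇑f)
    {kc : ℤ_[p]} (hkc : (kc : ℚ_[p]) = (((k : ℚ) / 12 : ℚ) : ℚ_[p])) :
    HasRationalPIntegralQExpansion p g (fun n => (n : ℤ_[p]) * x n -
      kc * ∑ ij ∈ antidiagonal n, ((if ij.1 = 0 then 1 else -24 * (σ 1 ij.1 : ℤ) : ℤ) : ℤ_[p]) * x ij.2) := by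
  choose a ha hxa using hf
  intro n
  refine ⟨n * a n - (k : ℚ) / 12 * ∑ ij ∈ antidiagonal n, ((if ij.1 = 0 then 1 else -24 * (σ 1 ij.1 : ℤ) : ℤ) : ℚ) * a ij.2,
    ?_, ?_⟩
  · rw [hg, qExpansion_serreDerivative_coeff, ha]
    have hterm : ∀ ij ∈ antidiagonal n, coeff ij.1 (qExpansion 1 E2) * coeff ij.2 (qExpansion 1 ⇑f) =
        ((((if ij.1 = 0 then 1 else -24 * (σ 1 ij.1 : ℤ) : ℤ) : ℚ) * a ij.2 : ℚ) : ℂ) := by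
      intro ij _
      rw [qExpansion_E2_coeff, ha]
      push_cast
      split_ifs <;> simp
    rw [sum_congr rfl hterm]
    push_cast
    ring
  · rw [PadicInt.coe_sub, PadicInt.coe_mul, PadicInt.coe_mul, hkc, PadicInt.coe_natCast, hxa, PadicInt.coe_sum]
    have hterm : ∀ ij ∈ antidiagonal n,
        ((((if ij.1 = 0 then 1 else -24 * (σ 1 ij.1 : ℤ) : ℤ) : ℤ_[p]) * x ij.2 : ℤ_[p]) : ℚ_[p]) =
          ((((if ij.1 = 0 then 1 else -24 * (σ 1 ij.1 : ℤ) : ℤ) : ℚ) * a ij.2 : ℚ) : ℚ_[p]) := by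
      intro ij _
      rw [PadicInt.coe_mul, PadicInt.coe_intCast, hxa]
      split_ifs <;> push_cast <;> ring
    rw [sum_congr rfl hterm]
    push_cast
    ring

end Literature.NumberTheory.ModularForms.ModP
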